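import Summits.AtomisticToContinuum.HydrodynamicLimit.Theorems.TwoClocksEquilibriumFastWindowLDBirthT12ZonalT1
import Summits.AtomisticToContinuum.HydrodynamicLimit.Theorems.TwoClocksEquilibriumFastWindowLDBirthT12GainDipoleGrowthB
import HarnessLib

/-!
# T1/T2 in the dipole sector `ℓ = 1`, I: the `ℓ = 1` Euler kernel of the Lorentz operator, (e-K₂) for dipole
# fields with VECTOR amplitude, and the a-priori class of the dipole profile (helper
# `t12_gainTerm_vdipole_sub_cubeMoment` of the line `birth`, crux `TwoClocks.EquilibriumFastWindowLD`,
# stmt-AtomisticToContinuum-14440; §5 ASSEMBLY, sector `ℓ = 1`, of the registered analytic sub-goal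
# `t12_logLinearPreimage_and_dipoleModulus`)

Items T1 (`ℓ = 1` part: `|Π₁ψ₀(v)| ≲ (A + C_g)(1+|v|)(1 + log(1+|v|))`) and T2 (the log-modulus
`‖Φ(r) - Φ(S)‖ ≲ (A + C_g)(1 + log(S/r))`, `1 ≤ r ≤ S`) of the sub-goal concern the dipole profile
`Φ = dipoleProfile ψ₀` (`Π₁ψ₀(v) = ⟪Φ(|v|), v⟫`) of a log-quadratic solution of `Lψ₀ = g`. Every ingredient is in
the tree: the exact sector equation `ν d = K₂d - K₁d - Π₁g` for `d := Π₁ψ₀` (`sectorEquation_dipolePart`,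
`…T12SectorEquations`), (e-K₂) on scalar dipole fields `⟪a, x⟫Θ(‖x‖)` in a general weight class
(`abs_gainTerm_dipole_sub_lorentzGain_le_weight`, `…T12GainDipoleGrowthB`), the slice form of the Lorentz operator
(`lorentzGain_dipole_eq_slice_poly`), (e-K₁) (`abs_lossTerm_le_of_quartic`), (e-ν) (`t12_collisionFrequency_le_pi`)
and the Euler–Volterra lemmas for `Φ(s) = (4/s⁴)∫₀ˢ t³Φ - γ(s)` (`…T12Euler`, `…T12EulerGrowthB`). This file, the
first of three (`…T12DipoleT1B`: the exact defect and its unified bound; `…T12DipoleT1C`: the two rounds and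
`t12_dipole_T1`), supplies the bookkeeping-free inputs:

* `lorentzGain_dipole_eq_cubeMoment` — THE `ℓ = 1` EULER KERNEL as an operator identity:
  `lorentzGain (⟪a, ·⟫Θ(‖·‖)) (s e) = (4π/s²)⟪a, e⟫∫₀ˢ r³Θ(r) dr` (the slice at partner rest is `⟪a, e⟫` times the
  Lorentz action on the RADIAL function `r²Θ(r)/s`, `s - s x² = (√(s² - (sx)²))²/s`; no change of variables by hand);
* `gainTerm_sum` and the registered **`t12_gainTerm_vdipole_sub_cubeMoment`** — (e-K₂) for a dipole field with
  VECTOR amplitude `⟪Ξ(‖x‖), x⟫ = Σᵢ ⟪eᵢ, x⟫ Ξᵢ(‖x‖)` in the weight class (`‖Ξ‖ ≤ mW`, `W ≥ 1` nondecreasing,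
  `W(s+t) ≤ W(s)(1+t)ⁿ`): `|K₂⟪Ξ(‖·‖), ·⟫(s e) - (4π/s²)⟪∫₀ˢ r³Ξ, e⟫| ≤ 3·16π M_{n+4} m W(s)(1+s)`, coordinate by
  coordinate;
* `dipoleField_apriori` — the class `s‖Φ(s)‖ ≤ 3A(1+s²)(1+log(1+s²))` (`s > 0`) of the dipole profile of a
  quadratic-log `ψ` (`norm_dipoleProfile_le_radial`): `d = ⟪Φ(‖·‖), ·⟫` is quartic and of Gaussian growth, `≤ 12A`
  on the unit ball, `‖Φ(t)‖ ≤ 12A(1+t)(1+log(1+t))` on `[1, ∞)` — but possibly UNBOUNDED as `t → 0` (for a merely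
  continuous `ψ`, `Φ(t) ~ t^{-1/2}` is possible), whence
* the TRUNCATION `Φ̃ = 1_{(1,∞)}Φ` (`norm_truncProfile_le`; `cubeMoment_truncProfile`:
  `∫₀ˢ t³Φ̃ = ∫₀ˢ t³Φ - ∫₀¹ t³Φ`) and the splitting `d = ⟪Φ̃(‖·‖), ·⟫ + d₀` with `|d₀| ≤ 12A` supported in the unit
  ball, `K₂d = K₂⟪Φ̃(‖·‖), ·⟫ + K₂d₀`, `|K₂d₀(v)| ≤ 12Aπ((4/3)|v|² + 14(1+|v|))` (`gainTerm_dipoleField_split`).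

[folklore] (Grad 1963 §4; Cercignani–Illner–Pulvirenti 1994 §7.2; the corrector-growth plan of the line `birth`, §5.)
-/

noncomputable section

open MeasureTheory ProbabilityTheory Real Set Filter Metric
open scoped ENNReal BigOperators InnerProductSpace

namespace Summit.AtomisticToContinuum.HydrodynamicLimit.Theorems.ClampedCorrectorBirth

open Literature.Analysis.FluidPDE Literature.MathematicalPhysics.KineticTheory
open Literature.Analysis.UnboundedOperators Literature.Probability.Distributions

/-! ### The Lorentz operator on dipole fields: the cube-moment (Euler–Volterra) kernel -/

variable {Θ : ℝ → ℝ} {C : ℝ} {k : ℕ}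

/-- **The `ℓ = 1` Euler kernel**: for `Θ` measurable of polynomial growth on `[0, ∞)`, a unit vector `e` and
`s > 0`, `lorentzGain (⟪a, ·⟫ Θ(‖·‖)) (s e) = (4π/s²) ⟪a, e⟫ ∫₀ˢ r³ Θ(r) dr` — the slice form
`4π⟪a, e⟫∫_{-1}^{1} (sx)₊ (s - s x²) Θ(√(s² - (sx)²)) dx` (`lorentzGain_dipole_eq_slice_poly`) is `⟪a, e⟫` times the
Lorentz action on the RADIAL function `r² Θ(r)/s` (`lorentzGain_radial_eq_slice`, `s - s x² = (√(s² - (sx)²))²/s`),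
which is `(4π/s)∫₀ˢ t · t²Θ(t)/s dt` (`lorentzGain_profile`). No change of variables by hand. [folklore] -/
theorem lorentzGain_dipole_eq_cubeMoment (a : EuclideanSpace ℝ (Fin 3)) (hΘ : Measurable Θ)
    (hp : ∀ t : ℝ, 0 ≤ t → |Θ t| ≤ C * (1 + t) ^ k) (e : sphere (0 : EuclideanSpace ℝ (Fin 3)) 1) {s : ℝ}
    (hs : 0 < s) :
    lorentzGain (fun x => ⟪a, x⟫_ℝ * Θ ‖x‖) (s • (e : EuclideanSpace ℝ (Fin 3))) =
      4 * π / s ^ 2 * ⟪a, (e : EuclideanSpace ℝ (Fin 3))⟫_ℝ * ∫ r in (0:ℝ)..s, r ^ 3 * Θ r := by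
  set v : EuclideanSpace ℝ (Fin 3) := s • (e : EuclideanSpace ℝ (Fin 3)) with hv
  have hvn : ‖v‖ = s := by rw [hv, norm_smul_sphere, abs_of_pos hs]
  have he : ‖(e : EuclideanSpace ℝ (Fin 3))‖ = 1 := norm_eq_of_mem_sphere e
  have hve : ∀ x : EuclideanSpace ℝ (Fin 3), ⟪v, x⟫_ℝ = ‖v‖ * ⟪(e : EuclideanSpace ℝ (Fin 3)), x⟫_ℝ :=
    fun x => by rw [hv, real_inner_smul_left, hvn]
  have hG : Measurable fun r : ℝ => r ^ 2 * Θ r / s := by fun_prop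
  have key : ∫ x in (-1:ℝ)..1, max (s * x) 0 * (s - s * x * x) * Θ (√(s ^ 2 - (s * x) ^ 2)) =
      ∫ x in (-1:ℝ)..1, max (s * x) 0 * (√(s ^ 2 - (s * x) ^ 2) ^ 2 * Θ (√(s ^ 2 - (s * x) ^ 2)) / s) := by
    refine intervalIntegral.integral_congr fun x hx => ?_
    rw [uIcc_of_le (by norm_num)] at hx
    have h0 : 0 ≤ s ^ 2 - (s * x) ^ 2 := by
      rw [show s ^ 2 - (s * x) ^ 2 = s ^ 2 * ((1 - x) * (1 + x)) by ring]
      exact mul_nonneg (sq_nonneg s) (mul_nonneg (by linarith [hx.2]) (by linarith [hx.1]))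
    rw [Real.sq_sqrt h0]
    field_simp
  have h1 := lorentzGain_dipole_eq_slice_poly a hΘ hp he hve
  rw [hvn] at h1
  have h2 := lorentzGain_radial_eq_slice hG v
  rw [hvn] at h2
  have h3 := lorentzGain_profile hG e hs
  have h4 : ∫ t in (0:ℝ)..s, t * (t ^ 2 * Θ t / s) = s⁻¹ * ∫ r in (0:ℝ)..s, r ^ 3 * Θ r := by
    rw [← intervalIntegral.integral_const_mul]
    refine intervalIntegral.integral_congr fun t _ => ?_
    field_simp
  rw [h1, key]
  calc 4 * π * ⟪a, (e : EuclideanSpace ℝ (Fin 3))⟫_ℝ *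
        ∫ x in (-1:ℝ)..1, max (s * x) 0 * (√(s ^ 2 - (s * x) ^ 2) ^ 2 * Θ (√(s ^ 2 - (s * x) ^ 2)) / s)
      = ⟪a, (e : EuclideanSpace ℝ (Fin 3))⟫_ℝ * (4 * π *
          ∫ x in (-1:ℝ)..1, max (s * x) 0 * (√(s ^ 2 - (s * x) ^ 2) ^ 2 * Θ (√(s ^ 2 - (s * x) ^ 2)) / s)) := by
        ring
    _ = ⟪a, (e : EuclideanSpace ℝ (Fin 3))⟫_ℝ * lorentzGain (fun x : EuclideanSpace ℝ (Fin 3) => ‖x‖ ^ 2 * Θ ‖x‖ / s) v := by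
        rw [h2]
    _ = ⟪a, (e : EuclideanSpace ℝ (Fin 3))⟫_ℝ * (4 * π / s * (s⁻¹ * ∫ r in (0:ℝ)..s, r ^ 3 * Θ r)) := by
        rw [hv, h3, h4]
    _ = _ := by
        field_simp

/-! ### Dipole fields with a VECTOR amplitude: `⟪Ξ(‖x‖), x⟫ = Σᵢ ⟪eᵢ, x⟫ Ξᵢ(‖x‖)` -/

/-- **`gainTerm` of a finite sum** on the Gaussian-growth class (`gainTerm_add` iterated). [folklore] -/
theorem gainTerm_sum {ι : Type*} (S : Finset ι) {u : ι → EuclideanSpace ℝ (Fin 3) → ℝ}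
    (hu : ∀ i, Measurable (u i)) {Cu : ι → ℝ}
    (hC : ∀ i x, |u i x| ≤ Cu i * Real.exp (‖x‖ ^ 2 / 4)) (v : EuclideanSpace ℝ (Fin 3)) :
    gainTerm (fun x => ∑ i ∈ S, u i x) v = ∑ i ∈ S, gainTerm (u i) v := by
  classical
  induction S using Finset.induction_on with
  | empty => simp [gainTerm]
  | @insert a S ha ih =>
    have hms : Measurable (fun x => ∑ i ∈ S, u i x) := Finset.measurable_sum S fun i _ => hu i
    have hCs : ∀ x, |∑ i ∈ S, u i x| ≤ (∑ i ∈ S, Cu i) * Real.exp (‖x‖ ^ 2 / 4) := fun x => by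
      rw [Finset.sum_mul]
      exact (Finset.abs_sum_le_sum_abs _ _).trans (Finset.sum_le_sum fun i _ => hC i x)
    simp only [Finset.sum_insert ha]
    rw [← ih]
    exact gainTerm_add (hu a) hms (hC a) hCs v

/-- Coordinates: `⟪X, x⟫ = Σᵢ ⟪eᵢ, x⟫ Xᵢ` with `eᵢ = EuclideanSpace.single i 1`. [folklore] -/
theorem inner_eq_sum_inner_single (X x : EuclideanSpace ℝ (Fin 3)) :
    ⟪X, x⟫_ℝ = ∑ i, ⟪EuclideanSpace.single i (1:ℝ), x⟫_ℝ * X i := by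
  simp [PiLp.inner_apply, mul_comm]

/-- A measurable vector function bounded in norm on `Ι a b` is interval integrable. [folklore] -/
theorem intervalIntegrable_of_norm_le {f : ℝ → EuclideanSpace ℝ (Fin 3)} (hf : Measurable f) {a b K : ℝ}
    (h : ∀ x ∈ uIoc a b, ‖f x‖ ≤ K) : IntervalIntegrable f volume a b :=
  intervalIntegrable_const.mono_fun' hf.aestronglyMeasurable
    ((ae_restrict_iff' measurableSet_uIoc).2 (Eventually.of_forall h))

/-- **Registered helper `t12_gainTerm_vdipole_sub_cubeMoment` — (e-K₂) for a dipole field with VECTOR amplitude in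
the weight class, against the `ℓ = 1` Euler kernel.**
For `W` nondecreasing, `≥ 1`, of polynomial increment `n` on `[0, ∞)`, `Ξ : ℝ → ℝ³` measurable with
`‖Ξ t‖ ≤ m W(t)` (`t ≥ 0`), a unit vector `e` and `s > 0`:
`|gainTerm ⟪Ξ(‖·‖), ·⟫ (s e) - (4π/s²)⟪∫₀ˢ r³ Ξ(r) dr, e⟫| ≤ 3 · 16π M_{n+4} m W(s)(1+s)` — coordinates
`⟪Ξ(‖x‖), x⟫ = Σᵢ ⟪eᵢ, x⟫ Ξᵢ(‖x‖)`, `gainTerm_sum`, the scalar comparison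
`abs_gainTerm_dipole_sub_lorentzGain_le_weight` and `lorentzGain_dipole_eq_cubeMoment` per coordinate. [folklore] -/
theorem t12_gainTerm_vdipole_sub_cubeMoment : ∀ (W : ℝ → ℝ) (m : ℝ) (n : ℕ) (Ξ : ℝ → EuclideanSpace ℝ (Fin 3)), (∀ a b : ℝ, 0 ≤ a → a ≤ b → W a ≤ W b) → (∀ a : ℝ, 0 ≤ a → 1 ≤ W a) → (∀ s t : ℝ, 0 ≤ s → 0 ≤ t → W (s + t) ≤ W s * (1 + t) ^ n) → Measurable Ξ → (∀ t : ℝ, 0 ≤ t → ‖Ξ t‖ ≤ m * W t) → ∀ (e : Metric.sphere (0 : EuclideanSpace ℝ (Fin 3)) 1) (s : ℝ), 0 < s → |Summit.AtomisticToContinuum.HydrodynamicLimit.Theorems.ClampedCorrectorBirth.gainTerm (fun x : EuclideanSpace ℝ (Fin 3) => inner ℝ (Ξ ‖x‖) x) (s • (e : EuclideanSpace ℝ (Fin 3))) - 4 * Real.pi / s ^ 2 * inner ℝ (∫ r in (0:ℝ)..s, r ^ 3 • Ξ r) (e : EuclideanSpace ℝ (Fin 3))| ≤ 3 * (16 * Real.pi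 * m * W s * (1 + s) * ∫ t, (1 + |t|) ^ (n + 4) ∂ProbabilityTheory.gaussianReal 0 1) := by
  intro W m n Ξ hW1 hW2 hW3 hΞ hΞw e s hs
  have hW : (∀ a b : ℝ, 0 ≤ a → a ≤ b → W a ≤ W b) ∧ (∀ a : ℝ, 0 ≤ a → 1 ≤ W a) ∧
      ∀ s t : ℝ, 0 ≤ s → 0 ≤ t → W (s + t) ≤ W s * (1 + t) ^ n := ⟨hW1, hW2, hW3⟩
  set v : EuclideanSpace ℝ (Fin 3) := s • (e : EuclideanSpace ℝ (Fin 3)) with hv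
  have hvn : ‖v‖ = s := by rw [hv, norm_smul_sphere, abs_of_pos hs]
  have hΞi : ∀ i, Measurable fun r => Ξ r i := fun i => by fun_prop
  have hΞwi : ∀ i t, 0 ≤ t → |Ξ t i| ≤ m * W t := fun i t ht => by
    refine le_trans ?_ (hΞw t ht)
    simpa [EuclideanSpace.inner_single_left, PiLp.norm_single] using
      abs_real_inner_le_norm (EuclideanSpace.single i (1:ℝ)) (Ξ t)
  have hpi : ∀ i t, 0 ≤ t → |Ξ t i| ≤ m * W 0 * (1 + t) ^ n :=
    fun i => polyGrowth_of_weightGrowth hW (hΞwi i)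
  have hm0 : 0 ≤ m := nonneg_of_weightGrowth hW (hΞwi 0)
  have hC0 : 0 ≤ m * W 0 := mul_nonneg hm0 (zero_le_one.trans (hW.2.1 0 le_rfl))
  set u : Fin 3 → EuclideanSpace ℝ (Fin 3) → ℝ :=
    fun i x => ⟪EuclideanSpace.single i (1:ℝ), x⟫_ℝ * Ξ ‖x‖ i with hu
  have hum : ∀ i, Measurable (u i) := fun i => by simp only [hu]; fun_prop
  have huC : ∀ i x, |u i x| ≤ m * W 0 * Real.exp ((((n + 1 : ℕ) : ℝ)) ^ 2) * Real.exp (‖x‖ ^ 2 / 4) :=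
    fun i x => by
      have h1 := abs_dipole_le_poly (hpi i) (EuclideanSpace.single i (1:ℝ)) x
      rw [PiLp.norm_single, norm_one, one_mul] at h1
      have h2 := polyWeight_gaussGrowth (k := n) hC0 ‖x‖ (norm_nonneg x)
      rw [abs_of_nonneg (by positivity)] at h2
      exact h1.trans h2
  have hsplit : (fun x => ⟪Ξ ‖x‖, x⟫_ℝ) = fun x => ∑ i, u i x :=
    funext fun x => inner_eq_sum_inner_single _ _
  have hgain : gainTerm (fun x => ⟪Ξ ‖x‖, x⟫_ℝ) v = ∑ i, gainTerm (u i) v := by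
    rw [hsplit]; exact gainTerm_sum _ hum huC v
  have hlor : ∀ i, lorentzGain (u i) v =
      4 * π / s ^ 2 * ⟪EuclideanSpace.single i (1:ℝ), (e : EuclideanSpace ℝ (Fin 3))⟫_ℝ *
        ∫ r in (0:ℝ)..s, r ^ 3 * Ξ r i :=
    fun i => lorentzGain_dipole_eq_cubeMoment _ (hΞi i) (hpi i) e hs
  have hint : IntervalIntegrable (fun r => r ^ 3 • Ξ r) volume 0 s := by
    refine intervalIntegrable_of_norm_le (by fun_prop) (K := s ^ 3 * (m * W s)) fun r hr => ?_
    rw [uIoc_of_le hs.le] at hr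
    rw [norm_smul, Real.norm_eq_abs, abs_of_nonneg (pow_nonneg hr.1.le 3)]
    exact mul_le_mul (pow_le_pow_left₀ hr.1.le hr.2 3)
      ((hΞw r hr.1.le).trans (mul_le_mul_of_nonneg_left (hW.1 r s hr.1.le hr.2) hm0))
      (norm_nonneg _) (by positivity)
  have hcomp : ∀ i, (∫ r in (0:ℝ)..s, r ^ 3 • Ξ r) i = ∫ r in (0:ℝ)..s, r ^ 3 * Ξ r i := fun i => by
    have h := (EuclideanSpace.proj i : EuclideanSpace ℝ (Fin 3) →L[ℝ] ℝ).intervalIntegral_comp_comm hint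
    simpa using h.symm
  have hL : ∑ i, lorentzGain (u i) v =
      4 * π / s ^ 2 * ⟪∫ r in (0:ℝ)..s, r ^ 3 • Ξ r, (e : EuclideanSpace ℝ (Fin 3))⟫_ℝ := by
    rw [inner_eq_sum_inner_single, Finset.mul_sum]
    refine Finset.sum_congr rfl fun i _ => ?_
    rw [hlor i, hcomp i]
    ring
  have hbound : ∀ i, |gainTerm (u i) v - lorentzGain (u i) v| ≤
      16 * π * m * W s * (1 + s) * ∫ t, (1 + |t|) ^ (n + 4) ∂gaussianReal 0 1 := fun i => by
    have h := abs_gainTerm_dipole_sub_lorentzGain_le_weight hW (hΞwi i) (hΞi i)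
      (EuclideanSpace.single i (1:ℝ)) v
    rw [PiLp.norm_single, norm_one, mul_one, hvn] at h
    exact h
  rw [hgain, ← hL, ← Finset.sum_sub_distrib]
  calc |∑ i, (gainTerm (u i) v - lorentzGain (u i) v)|
      ≤ ∑ i, |gainTerm (u i) v - lorentzGain (u i) v| := Finset.abs_sum_le_sum_abs _ _
    _ ≤ ∑ _i : Fin 3, 16 * π * m * W s * (1 + s) * ∫ t, (1 + |t|) ^ (n + 4) ∂gaussianReal 0 1 :=
        Finset.sum_le_sum fun i _ => hbound i
    _ = _ := by rw [Finset.sum_const, Finset.card_univ, Fintype.card_fin]; simp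


/-! ### The dipole profile class: a-priori consequences of `s ‖Φ(s)‖ ≤ 3A(1+s²)(1+log(1+s²))` -/

section Profile

variable {Φ : ℝ → EuclideanSpace ℝ (Fin 3)} {A : ℝ}

/-- A vector profile with `s‖Φ(s)‖ ≤ 3A(1+s²)(1+log(1+s²))` (`s > 0`; the dipole profile of a quadratic-log `ψ`,
`norm_dipoleProfile_le_radial`) has `0 ≤ A`; its dipole field `d(x) = ⟪Φ(‖x‖), x⟫` is quadratic-log (`3A`), quartic
(`3A`), of Gaussian growth (`96A`) and bounded by `12A` on the unit ball; `‖Φ(t)‖ ≤ 12A(1+t)(1+log(1+t))` for `t ≥ 1`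
and `‖t³Φ(t)‖ ≤ 12A` on `(0, 1]`. [folklore] -/
theorem dipoleField_apriori
    (hΦA : ∀ s, 0 < s → s * ‖Φ s‖ ≤ 3 * A * ((1 + s ^ 2) * (1 + Real.log (1 + s ^ 2)))) :
    0 ≤ A ∧
    (∀ x : EuclideanSpace ℝ (Fin 3), |⟪Φ ‖x‖, x⟫_ℝ| ≤ 3 * A * ((1 + ‖x‖ ^ 2) * (1 + Real.log (1 + ‖x‖ ^ 2)))) ∧
    (∀ x : EuclideanSpace ℝ (Fin 3), |⟪Φ ‖x‖, x⟫_ℝ| ≤ 3 * A * (1 + ‖x‖) ^ 4) ∧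
    (∀ x : EuclideanSpace ℝ (Fin 3), |⟪Φ ‖x‖, x⟫_ℝ| ≤ 96 * A * Real.exp (‖x‖ ^ 2 / 4)) ∧
    (∀ t, 1 ≤ t → ‖Φ t‖ ≤ 12 * A * ((1 + t) * (1 + Real.log (1 + t)))) ∧
    (∀ x : EuclideanSpace ℝ (Fin 3), ‖x‖ ≤ 1 → |⟪Φ ‖x‖, x⟫_ℝ| ≤ 12 * A) ∧
    (∀ t, 0 < t → t ≤ 1 → ‖t ^ 3 • Φ t‖ ≤ 12 * A) := by
  have hl2 : 0 ≤ Real.log (1 + (1:ℝ) ^ 2) := Real.log_nonneg (by norm_num)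
  have hA : 0 ≤ A := by
    have h := hΦA 1 one_pos
    by_contra hA'
    push Not at hA'
    have h2 : 3 * A * ((1 + (1:ℝ) ^ 2) * (1 + Real.log (1 + (1:ℝ) ^ 2))) < 0 := by nlinarith
    linarith [norm_nonneg (Φ 1)]
  have hd : ∀ x : EuclideanSpace ℝ (Fin 3),
      |⟪Φ ‖x‖, x⟫_ℝ| ≤ 3 * A * ((1 + ‖x‖ ^ 2) * (1 + Real.log (1 + ‖x‖ ^ 2))) := fun x => by
    by_cases hx : x = 0
    · subst hx
      simp only [inner_zero_right, abs_zero, norm_zero]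
      norm_num
      exact hA
    · calc |⟪Φ ‖x‖, x⟫_ℝ| ≤ ‖Φ ‖x‖‖ * ‖x‖ := abs_real_inner_le_norm _ _
        _ = ‖x‖ * ‖Φ ‖x‖‖ := mul_comm _ _
        _ ≤ _ := hΦA ‖x‖ (norm_pos_iff.2 hx)
  refine ⟨hA, hd, fun x => (hd x).trans ?_, fun x => (hd x).trans ?_, fun t ht => ?_, fun x hx => (hd x).trans ?_,
    fun t ht0 ht1 => ?_⟩
  · exact mul_le_mul_of_nonneg_left ((quadLog_le_pow_four_and_exp ‖x‖).1 (norm_nonneg x)) (by positivity)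
  · calc 3 * A * ((1 + ‖x‖ ^ 2) * (1 + Real.log (1 + ‖x‖ ^ 2))) ≤ 3 * A * (32 * Real.exp (‖x‖ ^ 2 / 4)) :=
          mul_le_mul_of_nonneg_left (quadLog_le_pow_four_and_exp ‖x‖).2 (by positivity)
      _ = 96 * A * Real.exp (‖x‖ ^ 2 / 4) := by ring
  · have ht0 : 0 < t := by linarith
    have h := (hΦA t ht0).trans (mul_le_mul_of_nonneg_left (quadLog_le_mul_linLog ht) (by positivity))
    have h' : t * ‖Φ t‖ ≤ t * (12 * A * ((1 + t) * (1 + Real.log (1 + t)))) := h.trans_eq (by ring)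
    exact le_of_mul_le_mul_left h' ht0
  · calc 3 * A * ((1 + ‖x‖ ^ 2) * (1 + Real.log (1 + ‖x‖ ^ 2))) ≤ 3 * A * 4 :=
          mul_le_mul_of_nonneg_left (quadLog_le_four (norm_nonneg x) hx) (by positivity)
      _ = 12 * A := by ring
  · have h := (hΦA t ht0).trans (mul_le_mul_of_nonneg_left (quadLog_le_four ht0.le ht1) (by positivity))
    rw [norm_smul, Real.norm_eq_abs, abs_of_nonneg (pow_nonneg ht0.le 3)]
    have ht2 : t ^ 2 ≤ 1 := by nlinarith
    calc t ^ 3 * ‖Φ t‖ = t ^ 2 * (t * ‖Φ t‖) := by ring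
      _ ≤ 1 * (3 * A * 4) := mul_le_mul ht2 h (mul_nonneg ht0.le (norm_nonneg _)) zero_le_one
      _ = 12 * A := by ring

/-- Class-bound transfer to the TRUNCATED profile `1_{(1,∞)} Φ`: a bound `‖Φ(t)‖ ≤ m W(t)` on `[1, ∞)` with `m, W ≥ 0`
holds for the truncation on all of `[0, ∞)`. [folklore] -/
theorem norm_truncProfile_le {Wt : ℝ → ℝ} {mt : ℝ} (hmt : 0 ≤ mt) (hWt : ∀ t, 0 ≤ t → 0 ≤ Wt t)
    (hΦW : ∀ t, 1 ≤ t → ‖Φ t‖ ≤ mt * Wt t) (t : ℝ) (ht : 0 ≤ t) :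
    ‖(Ioi (1:ℝ)).indicator Φ t‖ ≤ mt * Wt t := by
  by_cases h : t ∈ Ioi (1:ℝ)
  · rw [indicator_of_mem h]; exact hΦW t (le_of_lt h)
  · rw [indicator_of_notMem h, norm_zero]; exact mul_nonneg hmt (hWt t ht)

/-- **The cube moment of the truncated profile**: `∫₀ˢ t³ 1_{(1,∞)}Φ = ∫₀ˢ t³Φ - ∫₀¹ t³Φ` for `s ≥ 1` (all three
integrands are bounded and measurable; the truncation vanishes on `[0, 1]` and agrees with `Φ` on `(1, s]`). [folklore] -/
theorem cubeMoment_truncProfile (hΦm : Measurable Φ)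
    (hΦA : ∀ s, 0 < s → s * ‖Φ s‖ ≤ 3 * A * ((1 + s ^ 2) * (1 + Real.log (1 + s ^ 2)))) {s : ℝ} (hs : 1 ≤ s) :
    ∫ t in (0:ℝ)..s, t ^ 3 • (Ioi (1:ℝ)).indicator Φ t =
      (∫ t in (0:ℝ)..s, t ^ 3 • Φ t) - ∫ t in (0:ℝ)..1, t ^ 3 • Φ t := by
  obtain ⟨hA, -, -, -, hLL, -, h01⟩ := dipoleField_apriori hΦA
  have hmono := logLinearWeight_class.1
  have hK : ∀ t ∈ uIoc (0:ℝ) s, ‖t ^ 3 • Φ t‖ ≤ 12 * A + s ^ 3 * (12 * A * ((1 + s) * (1 + Real.log (1 + s)))) := by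
    intro t ht
    rw [uIoc_of_le (by linarith)] at ht
    have hnn1 : 0 ≤ s ^ 3 * (12 * A * ((1 + s) * (1 + Real.log (1 + s)))) := by
      have := (one_add_le_linLog (by linarith : (0:ℝ) ≤ s)).2; positivity
    rcases le_or_gt t 1 with ht1 | ht1
    · linarith [h01 t ht.1 ht1]
    · rw [norm_smul, Real.norm_eq_abs, abs_of_nonneg (pow_nonneg ht.1.le 3)]
      have h1 : t ^ 3 * ‖Φ t‖ ≤ s ^ 3 * (12 * A * ((1 + s) * (1 + Real.log (1 + s)))) :=
        mul_le_mul (pow_le_pow_left₀ ht.1.le ht.2 3) ((hLL t ht1.le).trans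
          (mul_le_mul_of_nonneg_left (hmono t s (by linarith) ht.2) (by positivity))) (norm_nonneg _) (by positivity)
      linarith [mul_nonneg (by norm_num : (0:ℝ) ≤ 12) hA]
  have hKt : ∀ t ∈ uIoc (0:ℝ) s, ‖t ^ 3 • (Ioi (1:ℝ)).indicator Φ t‖ ≤
      12 * A + s ^ 3 * (12 * A * ((1 + s) * (1 + Real.log (1 + s)))) := fun t ht => by
    refine le_trans ?_ (hK t ht)
    rw [norm_smul, norm_smul]
    exact mul_le_mul_of_nonneg_left (norm_indicator_le_norm_self _ _) (norm_nonneg _)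
  have hsub : uIcc (0:ℝ) 1 ⊆ uIcc 0 s := by
    rw [uIcc_of_le zero_le_one, uIcc_of_le (by linarith)]; exact Icc_subset_Icc le_rfl hs
  have hsub' : uIcc (1:ℝ) s ⊆ uIcc 0 s := by
    rw [uIcc_of_le hs, uIcc_of_le (by linarith)]; exact Icc_subset_Icc zero_le_one le_rfl
  have i0s : IntervalIntegrable (fun t => t ^ 3 • Φ t) volume 0 s := intervalIntegrable_of_norm_le (by fun_prop) hK
  have it0s : IntervalIntegrable (fun t => t ^ 3 • (Ioi (1:ℝ)).indicator Φ t) volume 0 s :=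
    intervalIntegrable_of_norm_le ((measurable_id.pow_const 3).smul (hΦm.indicator measurableSet_Ioi)) hKt
  rw [intervalIntegral.integral_interval_sub_left i0s (i0s.mono_set hsub),
    ← intervalIntegral.integral_add_adjacent_intervals (it0s.mono_set hsub) (it0s.mono_set hsub')]
  have z : ∫ t in (0:ℝ)..1, t ^ 3 • (Ioi (1:ℝ)).indicator Φ t = ∫ _ in (0:ℝ)..1, (0 : EuclideanSpace ℝ (Fin 3)) := by
    refine intervalIntegral.integral_congr fun t ht => ?_
    rw [uIcc_of_le zero_le_one] at ht
    rw [indicator_of_notMem (notMem_Ioi.2 ht.2), smul_zero]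
  have w : ∫ t in (1:ℝ)..s, t ^ 3 • (Ioi (1:ℝ)).indicator Φ t = ∫ t in (1:ℝ)..s, t ^ 3 • Φ t := by
    refine intervalIntegral.integral_congr_ae (Eventually.of_forall fun t ht => ?_)
    rw [uIoc_of_le hs] at ht
    rw [indicator_of_mem (mem_Ioi.2 ht.1)]
  rw [z, intervalIntegral.integral_zero, w, zero_add]

/-- **Splitting off the unit ball.** With the truncation `Φ̃ = 1_{(1,∞)}Φ`, the dipole field splits as
`d = d₁ + d₀`, `d₁ = ⟪Φ̃(‖·‖), ·⟫`, `d₀ = d - d₁` supported in the closed unit ball and bounded by `12A`; hence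
`K₂d = K₂d₁ + K₂d₀` (`gainTerm_add`) with `|K₂d₀(v)| ≤ 12Aπ((4/3)|v|² + 14(1+|v|))` (`abs_gainTerm_le_weight`). [folklore] -/
theorem gainTerm_dipoleField_split (hΦm : Measurable Φ)
    (hΦA : ∀ s, 0 < s → s * ‖Φ s‖ ≤ 3 * A * ((1 + s ^ 2) * (1 + Real.log (1 + s ^ 2))))
    (v : EuclideanSpace ℝ (Fin 3)) :
    gainTerm (fun x : EuclideanSpace ℝ (Fin 3) => ⟪Φ ‖x‖, x⟫_ℝ) v =
        gainTerm (fun x : EuclideanSpace ℝ (Fin 3) => ⟪(Ioi (1:ℝ)).indicator Φ ‖x‖, x⟫_ℝ) v +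
          gainTerm (fun x : EuclideanSpace ℝ (Fin 3) => ⟪Φ ‖x‖, x⟫_ℝ - ⟪(Ioi (1:ℝ)).indicator Φ ‖x‖, x⟫_ℝ) v ∧
      |gainTerm (fun x : EuclideanSpace ℝ (Fin 3) => ⟪Φ ‖x‖, x⟫_ℝ - ⟪(Ioi (1:ℝ)).indicator Φ ‖x‖, x⟫_ℝ) v| ≤
        12 * A * π * (4 / 3 * ‖v‖ ^ 2 + 14 * (1 + ‖v‖)) := by
  obtain ⟨hA, -, -, hd96, -, hd12, -⟩ := dipoleField_apriori hΦA
  have hΦtm : Measurable ((Ioi (1:ℝ)).indicator Φ) := hΦm.indicator measurableSet_Ioi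
  have hd₁m : Measurable (fun x : EuclideanSpace ℝ (Fin 3) => ⟪(Ioi (1:ℝ)).indicator Φ ‖x‖, x⟫_ℝ) :=
    (hΦtm.comp measurable_norm).inner measurable_id
  have hd₀m : Measurable (fun x : EuclideanSpace ℝ (Fin 3) => ⟪Φ ‖x‖, x⟫_ℝ - ⟪(Ioi (1:ℝ)).indicator Φ ‖x‖, x⟫_ℝ) :=
    ((hΦm.comp measurable_norm).inner measurable_id).sub hd₁m
  have hd₀b : ∀ x : EuclideanSpace ℝ (Fin 3), |⟪Φ ‖x‖, x⟫_ℝ - ⟪(Ioi (1:ℝ)).indicator Φ ‖x‖, x⟫_ℝ| ≤ 12 * A :=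
    fun x => by
      by_cases hx : ‖x‖ ∈ Ioi (1:ℝ)
      · rw [indicator_of_mem hx, sub_self, abs_zero]; positivity
      · rw [indicator_of_notMem hx, inner_zero_left, sub_zero]; exact hd12 x (not_lt.1 hx)
  have hd₁C : ∀ x : EuclideanSpace ℝ (Fin 3), |⟪(Ioi (1:ℝ)).indicator Φ ‖x‖, x⟫_ℝ| ≤ 96 * A * Real.exp (‖x‖ ^ 2 / 4) :=
    fun x => by
      by_cases hx : ‖x‖ ∈ Ioi (1:ℝ)
      · rw [indicator_of_mem hx]; exact hd96 x
      · rw [indicator_of_notMem hx, inner_zero_left, abs_zero]; positivity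
  have hd₀C : ∀ x : EuclideanSpace ℝ (Fin 3), |⟪Φ ‖x‖, x⟫_ℝ - ⟪(Ioi (1:ℝ)).indicator Φ ‖x‖, x⟫_ℝ| ≤
      12 * A * Real.exp (‖x‖ ^ 2 / 4) := fun x =>
    (hd₀b x).trans (le_mul_of_one_le_right (by positivity) (Real.one_le_exp (by positivity)))
  have hd₀lin : ∀ x : EuclideanSpace ℝ (Fin 3), |⟪Φ ‖x‖, x⟫_ℝ - ⟪(Ioi (1:ℝ)).indicator Φ ‖x‖, x⟫_ℝ| ≤
      12 * A * (1 + ‖x‖) := fun x =>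
    (hd₀b x).trans (le_mul_of_one_le_right (by positivity) (by linarith [norm_nonneg x]))
  refine ⟨?_, abs_gainTerm_le_weight hd₀lin v⟩
  rw [← gainTerm_add hd₁m hd₀m hd₁C hd₀C v]
  congr 1
  funext x
  ring

end Profile

end Summit.AtomisticToContinuum.HydrodynamicLimit.Theorems.ClampedCorrectorBirth

end
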